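import Summits.ResolutionOfSingularities.ResolutionOfSingularities.Theses.RuledResidues
import Literature.AlgebraicGeometry.Resolution.DivisorialPlace
import Literature.AlgebraicGeometry.Resolution.ResolutionLU
import Literature.RingTheory.RegularLocalRing.QuotientDVR
import HarnessLib

/-!
# Line `regular-atlas` for crux `NonRuledCofinite` (stmt-ResolutionOfSingularities-18076)

Route `ResolutionOfSingularities/RuledResidues` (refutation-shaped certificate route; deciding theorem
`closes : NonRuledDivisors → RegularModelRuled → NonRuledCofinite → ¬ ResolutionOfSingularities`).
Crux (fixed, rank 3, TRUE — provable-grade, size L): for an affine model `R ⊆ K` over `k`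
(`R` finitely generated, `Frac R = K`) with `Scheme.HasResolution (Spec R)`, the set of valuation rings
`W` of `K` with `k ⊆ W`, `W` a DVR essentially of finite type, CENTRED IN `Sing R`
(`R_{𝔪_W ∩ R}` not regular) and NOT dominating a regular local ring of dimension `≥ 2` of any affine
model `A ⊆ W`, is FINITE.

Strategist line (crux-strategist seat `planner-cstrat-stmt-ResolutionOfSingularities-18076-b1-0`,
2026-08-17). TECHNIQUE WITH TEETH (transfer lens): the tree's "resolution ⇒ local uniformization"
theorem `Literature.AlgebraicGeometry.Resolution.exists_fg_regular_of_hasResolution` (ResolutionLU.lean: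
valuative criterion of properness + regular centre + affine neighbourhood `Γ(X,V) ↪ K`) made UNIFORM in
the valuation ring: the uniformizing algebra `T` can be drawn from the FINITELY MANY coordinate rings of
an affine atlas of the resolution `X` (quasi-compact), embedded in `K` once and for all through the
function field of the integral scheme `X`. After that single scheme-theoretic step everything is
commutative algebra inside `K`, for which the tree already has the centre / `B_𝔭`-place API
(`PrimeDivisors.lean`, `DivisorialPlace.lean`).

## The cut (three registered stubs; `NonRuledCofinite_of` proved from their STATEMENTS)

* `stub_finiteRegularAtlas` — FINITE REGULAR ATLAS (hardest, size L; the only stub that sees a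
  scheme). `HasResolution (Spec R)` ⇒ finitely many finitely generated `k`-subalgebras `B ⊇ R` of `K`,
  each a REGULAR ring (`IsRegularRing`), such that every valuation ring `W ⊇ R` of `K` contains one
  of them. (`X → Spec R` the resolution; `X` is integral with function field `K` because `π` is an
  isomorphism over a dense open of the irreducible `Spec R` and regular local rings are domains; finite
  affine cover `V₁ … Vₙ` of the quasi-compact `X`; `Bᵢ :=` image of `Γ(X, Vᵢ) ↪ K`, regular by
  `Scheme.IsRegular.isRegularRing_of_isAffineOpen`, finitely generated because `π` is locally of finite
  type; a valuation ring `W ⊇ R` has a centre `x ∈ Vᵢ` on the proper `X` (valuative criterion, verbatim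
  the first half of `exists_fg_regular_of_hasResolution`) and `Bᵢ ⊆ 𝒪_{X,x} ⊆ W`; the embedding
  `Γ(X,Vᵢ) ↪ K` over `R` is unique, since `K = Frac R` and the embedding is injective.)
* `stub_exceptionalCentre` — WHAT AN EXCEPTIONAL PLACE LOOKS LIKE ON A REGULAR CHART (size M; pure
  algebra). `R ≤ B ⊆ W`, `B` a regular affine model: if `W` is centred in `Sing R` and dominates no
  regular local ring of dimension `≥ 2` of an affine model, then the centre `𝔭 = 𝔪_W ∩ B` has HEIGHT
  ONE and `W = B_𝔭` elementwise (`z ∈ W ↔ z = a/s`, `a, s ∈ B`, `s ∉ 𝔭`). (`B_𝔭` is regular of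
  dimension `ht 𝔭`; `ht 𝔭 ≥ 2` is excluded by the hypothesis with `A := B`; `ht 𝔭 = 0` forces
  `𝔪_W ∩ R = 0`, whose local ring `K` is regular, excluded by the `Sing` clause; `ht 𝔭 = 1` makes `B_𝔭`
  a DVR (`isDiscreteValuationRing_of_ringKrullDim_eq_one`) and a valuation ring dominating a DVR with
  the same fraction field equals it: `mem_iff_exists_eq_div_of_primeDivisor`.)
* `stub_exceptionalPrimesFinite` — A BIRATIONAL AFFINE CHART IS AN ISOMORPHISM OFF FINITELY MANY
  PRIME DIVISORS (size M; pure algebra). `R ≤ B` finitely generated `k`-subalgebras of `K = Frac R`: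
  the height-one primes `𝔭` of `B` with `B_𝔭` regular but `R_{𝔭 ∩ R}` not regular are finitely many.
  (Common denominator `0 ≠ f ∈ R` of the generators of `B`: for `f ∉ 𝔭`, `R_{𝔭∩R} = B_𝔭` inside `K`;
  the height-one primes containing `f` are minimal over `(f)`, finitely many in the Noetherian `B`:
  `Ideal.finite_minimalPrimes_of_isNoetherianRing`.)

Composition `NonRuledCofinite_of` (sorry-free): the crux set `𝒮` satisfies
`𝒮 ⊆ ⋃_{B ∈ 𝓑} ⋃_{𝔭 ∈ T_B} {W | ∀ z, z ∈ W ↔ ∃ a s ∈ B, s ∉ 𝔭, z = a/s}` with `𝓑` the finite atlas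
(stub 1), `T_B` the finite exceptional prime set of the chart (stub 3) — membership by stub 2 — and each
innermost set is a subsingleton (a valuation subring is determined by its elements). The divisorial
conjuncts `k ⊆ W`, `DVR W`, "essentially of finite type" of the crux are NOT used (refuter crux-attack
note 2026-08-17: the superset `{W | Sing-centre ∧ no good model}` is already finite).

Disproof used: no `Disproof.lean` exists for this crux (payload `disproof_path` absent on disk,
`ledger crux ls`: no workfiles); `ledger negatives --problem ResolutionOfSingularities`: nothing bearing
on this statement. Dead lines: none recorded (`Lines/` empty; the opening planner's BC3 birth skeleton
`NonRuledCofinite_birth.lean` — "finitely many everywhere-regular charts + per-chart finiteness via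
denominator ideals" — is evidence-only and not readable from this hub; this line has the same spine,
typed, with the per-chart step split into the `W = B_𝔭` identification and the prime count).
-/

noncomputable section

set_option linter.dupNamespace false

open AlgebraicGeometry IsLocalRing
open Literature.AlgebraicGeometry.Resolution

namespace Summit.ResolutionOfSingularities.ResolutionOfSingularities.Cruxes.NonRuledCofinite.RegularAtlas

/-! ## The three pieces, as propositions (the binders of `NonRuledCofinite_of`) -/

/-- **Finite regular atlas of the Riemann–Zariski space over `R` from a resolution of `Spec R`.**
If the affine model `R` of `K/k` has a resolution of singularities, there are finitely many finitely
generated REGULAR `k`-subalgebras `B ⊇ R` of `K` such that every valuation ring of `K` containing `R`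
contains one of them. -/
def FiniteRegularAtlas : Prop :=
  ∀ (k K : Type) [Field k] [Field K] [Algebra k K] (R : Subalgebra k K), R.FG → IsFractionRing R K →
    Literature.AlgebraicGeometry.Resolution.Scheme.HasResolution (Spec (CommRingCat.of R)) →
    ∃ 𝓑 : Set (Subalgebra k K), 𝓑.Finite ∧
      (∀ B ∈ 𝓑, R ≤ B ∧ B.FG ∧ IsRegularRing B) ∧
      ∀ W : ValuationSubring K, R.toSubring ≤ W.toSubring → ∃ B ∈ 𝓑, B.toSubring ≤ W.toSubring

/-- **An exceptional place on a regular chart is the place of a height-one prime.** For a regular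
affine model `B ⊇ R` inside a valuation ring `W` of `K`: if the centre of `W` on `R` is a non-regular
point and `W` dominates no regular local ring of dimension `≥ 2` of an affine model, then the centre
`𝔭 = 𝔪_W ∩ B` has height one and `W = B_𝔭 = {a / s | a ∈ B, s ∈ B ∖ 𝔭}`. -/
def ExceptionalCentre : Prop :=
  ∀ (k K : Type) [Field k] [Field K] [Algebra k K] (R B : Subalgebra k K), R ≤ B → B.FG →
    IsFractionRing B K → IsRegularRing B →
    ∀ (W : ValuationSubring K) (hBW : B.toSubring ≤ W.toSubring),
      (∃ h : R.toSubring ≤ W.toSubring, ¬ IsRegularLocalRing (Localization.AtPrime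
        (Ideal.comap (Subring.inclusion h) (IsLocalRing.maximalIdeal W)))) →
      (¬ ∃ A : Subalgebra k K, A.FG ∧ IsFractionRing A K ∧ ∃ h : A.toSubring ≤ W.toSubring,
        IsRegularLocalRing (Localization.AtPrime
          (Ideal.comap (Subring.inclusion h) (IsLocalRing.maximalIdeal W))) ∧
        (2 : WithBot ℕ∞) ≤ ringKrullDim (Localization.AtPrime
          (Ideal.comap (Subring.inclusion h) (IsLocalRing.maximalIdeal W)))) →
      (centreIdeal B W hBW).height = 1 ∧
        ∀ z : K, z ∈ W ↔ ∃ a s : B, s ∉ centreIdeal B W hBW ∧ z = a / s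

/-- **A birational affine chart is an isomorphism off finitely many prime divisors.** For finitely
generated `k`-subalgebras `R ≤ B` of `K = Frac R`, the height-one primes `𝔭` of `B` at which `B_𝔭` is
regular but `R_{𝔭 ∩ R}` is not are finitely many (they all contain a common denominator `f ∈ R ∖ 0`
of the generators of `B`, off which `R_{𝔭 ∩ R} = B_𝔭`). -/
def ExceptionalPrimesFinite : Prop :=
  ∀ (k K : Type) [Field k] [Field K] [Algebra k K] (R B : Subalgebra k K) (hRB : R ≤ B),
    R.FG → B.FG → IsFractionRing R K →
    {𝔭 : PrimeSpectrum B | 𝔭.asIdeal.height = 1 ∧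
      IsRegularLocalRing (Localization.AtPrime 𝔭.asIdeal) ∧
      ¬ IsRegularLocalRing (Localization.AtPrime
        (𝔭.asIdeal.comap (Subalgebra.inclusion hRB).toRingHom))}.Finite

/-! ## The registered stubs -/

/-- STUB 1 (hardest, size L — the scheme-theoretic interface): finite regular atlas. Why plausibly
true: it IS true — quasi-compactness of the resolution `X`, integrality of `X` (birational to the
integral `Spec R`, regular stalks are domains), the valuative criterion of properness (first half of
`exists_fg_regular_of_hasResolution`, ResolutionLU.lean) and `Scheme.IsRegular.isRegularRing_of_isAffineOpen`;
the `R`-embedding `Γ(X,V) ↪ K` is unique because it is injective and `K = Frac R`. -/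
theorem stub_finiteRegularAtlas (k K : Type) [Field k] [Field K] [Algebra k K] (R : Subalgebra k K)
    (hR : R.FG) (hfr : IsFractionRing R K)
    (hres : Literature.AlgebraicGeometry.Resolution.Scheme.HasResolution (Spec (CommRingCat.of R))) :
    ∃ 𝓑 : Set (Subalgebra k K), 𝓑.Finite ∧
      (∀ B ∈ 𝓑, R ≤ B ∧ B.FG ∧ IsRegularRing B) ∧
      ∀ W : ValuationSubring K, R.toSubring ≤ W.toSubring → ∃ B ∈ 𝓑, B.toSubring ≤ W.toSubring := by
  sorry

/-- STUB 2 (size M — pure commutative algebra inside `K`): an exceptional place on a regular chart is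
the place of its centre, a height-one prime. Why true: `B_𝔭` is regular of dimension `ht 𝔭`
(`IsLocalization.AtPrime.ringKrullDim_eq_height`); `ht 𝔭 ≥ 2` contradicts the no-good-model clause
with `A := B`; `ht 𝔭 = 0` gives `𝔭 = 0`, so the centre on `R` is `0` and `R_(0) = K` is regular
(`isRegularLocalRing_of_isField`), contradicting the `Sing` clause; `ht 𝔭 = 1` makes `B_𝔭` a DVR
(`isDiscreteValuationRing_of_ringKrullDim_eq_one`, QuotientDVR.lean) and then `W = B_𝔭`
(`mem_iff_exists_eq_div_of_primeDivisor`, PrimeDivisors.lean). -/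
theorem stub_exceptionalCentre (k K : Type) [Field k] [Field K] [Algebra k K] (R B : Subalgebra k K)
    (hRB : R ≤ B) (hB : B.FG) (hBfr : IsFractionRing B K) (hreg : IsRegularRing B)
    (W : ValuationSubring K) (hBW : B.toSubring ≤ W.toSubring)
    (hsing : ∃ h : R.toSubring ≤ W.toSubring, ¬ IsRegularLocalRing (Localization.AtPrime
      (Ideal.comap (Subring.inclusion h) (IsLocalRing.maximalIdeal W))))
    (hexc : ¬ ∃ A : Subalgebra k K, A.FG ∧ IsFractionRing A K ∧ ∃ h : A.toSubring ≤ W.toSubring,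
      IsRegularLocalRing (Localization.AtPrime
        (Ideal.comap (Subring.inclusion h) (IsLocalRing.maximalIdeal W))) ∧
      (2 : WithBot ℕ∞) ≤ ringKrullDim (Localization.AtPrime
        (Ideal.comap (Subring.inclusion h) (IsLocalRing.maximalIdeal W)))) :
    (centreIdeal B W hBW).height = 1 ∧
      ∀ z : K, z ∈ W ↔ ∃ a s : B, s ∉ centreIdeal B W hBW ∧ z = a / s := by
  sorry

/-- STUB 3 (size M — pure commutative algebra inside `K`): a birational affine chart `R ≤ B` is an
isomorphism at all but finitely many height-one primes of `B`. Why true: the generators of `B` over `k`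
have a common denominator `0 ≠ f ∈ R` (`IsFractionRing.div_surjective`); for `f ∉ 𝔭` the local rings
`R_{𝔭 ∩ R} ⊆ B_𝔭` coincide inside `K`, so regularity transfers; the height-one primes containing `f`
are minimal primes of `(f)`, a finite set (`Ideal.finite_minimalPrimes_of_isNoetherianRing`). -/
theorem stub_exceptionalPrimesFinite (k K : Type) [Field k] [Field K] [Algebra k K]
    (R B : Subalgebra k K) (hRB : R ≤ B) (hR : R.FG) (hB : B.FG) (hfr : IsFractionRing R K) :
    {𝔭 : PrimeSpectrum B | 𝔭.asIdeal.height = 1 ∧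
      IsRegularLocalRing (Localization.AtPrime 𝔭.asIdeal) ∧
      ¬ IsRegularLocalRing (Localization.AtPrime
        (𝔭.asIdeal.comap (Subalgebra.inclusion hRB).toRingHom))}.Finite := by
  sorry

/-! ## Glue lemmas (proved) -/

/-- Regularity of the local ring at a prime is invariant under equality of the prime. [folklore] -/
theorem isRegularLocalRing_localization_congr {S : Type*} [CommRing S] {I J : Ideal S}
    [I.IsPrime] [J.IsPrime] (e : I = J) :
    IsRegularLocalRing (Localization.AtPrime I) ↔ IsRegularLocalRing (Localization.AtPrime J) := by
  subst e
  exact Iff.rfl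

/-- The centre of `W` on `R ≤ B ⊆ W` is the contraction of its centre on `B`. [folklore] -/
theorem comap_centreIdeal_eq {k K : Type} [Field k] [Field K] [Algebra k K] {R B : Subalgebra k K}
    (hRB : R ≤ B) (W : ValuationSubring K) (hBW : B.toSubring ≤ W.toSubring)
    (hRW : R.toSubring ≤ W.toSubring) :
    (centreIdeal B W hBW).comap (Subalgebra.inclusion hRB).toRingHom =
      Ideal.comap (Subring.inclusion hRW) (IsLocalRing.maximalIdeal W) := by
  ext x
  simp only [centreIdeal, Ideal.mem_comap]
  exact Iff.rfl

/-! ## The composition: the crux from the three stub STATEMENTS (sorry-free) -/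

/-- **COMPOSITION.** `FiniteRegularAtlas → ExceptionalCentre → ExceptionalPrimesFinite →
NonRuledCofinite`, concluding the route decl BY NAME. The crux set is contained in the finite union,
over the charts `B` of the atlas and the exceptional primes `𝔭` of each chart, of the subsingletons
`{W | W = B_𝔭 elementwise}`. -/
theorem NonRuledCofinite_of (h₁ : FiniteRegularAtlas) (h₂ : ExceptionalCentre)
    (h₃ : ExceptionalPrimesFinite) :
    Summit.ResolutionOfSingularities.ResolutionOfSingularities.Theses.RuledResidues.NonRuledCofinite := by
  intro k K _ _ _ R hR hfr hres
  classical
  obtain ⟨𝓑, h𝓑fin, h𝓑, hcov⟩ := h₁ k K R hR hfr hres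
  -- the exceptional places seen from the chart `B`
  let E : Subalgebra k K → Set (ValuationSubring K) := fun B =>
    {W | B.toSubring ≤ W.toSubring ∧
      (∃ h : R.toSubring ≤ W.toSubring, ¬ IsRegularLocalRing (Localization.AtPrime
        (Ideal.comap (Subring.inclusion h) (IsLocalRing.maximalIdeal W)))) ∧
      ¬ ∃ A : Subalgebra k K, A.FG ∧ IsFractionRing A K ∧ ∃ h : A.toSubring ≤ W.toSubring,
        IsRegularLocalRing (Localization.AtPrime
          (Ideal.comap (Subring.inclusion h) (IsLocalRing.maximalIdeal W))) ∧
        (2 : WithBot ℕ∞) ≤ ringKrullDim (Localization.AtPrime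
          (Ideal.comap (Subring.inclusion h) (IsLocalRing.maximalIdeal W)))}
  have hE : ∀ B ∈ 𝓑, (E B).Finite := by
    intro B hB
    obtain ⟨hRB, hBfg, hBreg⟩ := h𝓑 B hB
    have hBfr : IsFractionRing B K := isFractionRing_of_le hRB hfr
    -- the places `B_𝔭`, `𝔭` an exceptional height-one prime of the chart
    let P : PrimeSpectrum B → Set (ValuationSubring K) := fun 𝔭 =>
      {W | ∀ z : K, z ∈ W ↔ ∃ a s : B, s ∉ 𝔭.asIdeal ∧ z = a / s}
    have hT := h₃ k K R B hRB hR hBfg hfr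
    refine Set.Finite.subset (hT.biUnion (t := P) fun 𝔭 _ => ?_) ?_
    · refine Set.Subsingleton.finite ?_
      intro W hW W' hW'
      ext z
      exact (hW z).trans (hW' z).symm
    · rintro W ⟨hBW, hsing, hexc⟩
      obtain ⟨hht, hmem⟩ := h₂ k K R B hRB hBfg hBfr hBreg W hBW hsing hexc
      obtain ⟨hRW, hnreg⟩ := hsing
      haveI := hBreg
      have hregp : IsRegularLocalRing (Localization.AtPrime (centreIdeal B W hBW)) := inferInstance
      have hnregp : ¬ IsRegularLocalRing (Localization.AtPrime
          ((centreIdeal B W hBW).comap (Subalgebra.inclusion hRB).toRingHom)) := by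
        rwa [isRegularLocalRing_localization_congr (comap_centreIdeal_eq hRB W hBW hRW)]
      exact Set.mem_biUnion (x := (⟨centreIdeal B W hBW, inferInstance⟩ : PrimeSpectrum B))
        ⟨hht, hregp, hnregp⟩ hmem
  refine Set.Finite.subset (h𝓑fin.biUnion hE) ?_
  rintro W ⟨-, -, -, ⟨hRW, hnr⟩, hexc⟩
  obtain ⟨B, hB, hBW⟩ := hcov W hRW
  exact Set.mem_biUnion hB ⟨hBW, ⟨hRW, hnr⟩, hexc⟩

/-- The crux from the three registered stubs (its only `sorry`s are inside `stub_*`). -/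
theorem nonRuledCofinite_of_stubs :
    Summit.ResolutionOfSingularities.ResolutionOfSingularities.Theses.RuledResidues.NonRuledCofinite :=
  NonRuledCofinite_of stub_finiteRegularAtlas stub_exceptionalCentre stub_exceptionalPrimesFinite

end Summit.ResolutionOfSingularities.ResolutionOfSingularities.Cruxes.NonRuledCofinite.RegularAtlas

end
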